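import Literature.MathematicalPhysics.QuantumManyBody.BoseGasSubcellCondensationSharp
import HarnessLib

/-!
# Crux `BECTangentRigidity.TangentTransfer` (stmt-AtomisticToContinuum-13033), line `registered` (v2):
# STUB `stub_floorSharp` — the sharp pinned mesoscopic floor

For every repulsive finite-range pair potential `v` (hard cores allowed) with positive scattering
length, every `η ∈ (0,1)` and every `M ≥ 1` there is `ρ₀ = ρ₀(η, M, v) > 0` such that for
`0 < ρ < ρ₀`, eventually in `N`, every `δ`-near-minimiser `Ψ` (`δ = 1`) of the Dirichlet energy in
the box of side `L = (N/ρ)^{1/3}` and every dyadic level `k` with `M/√ρ ≤ L/2^k < 2M/√ρ` satisfy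
`cohSum N L k Ψ ≥ (1-η)N`: the `8^k` flat cell modes of side `L/2^k` carry all but a fraction `η` of
the particles.  This is the landed stub `stub_mesoscopicFloorPinned` (threshold `7/8`) with `7/8`
replaced by `1 - η`.

Proof: the Literature theorem
`Literature.MathematicalPhysics.QuantumManyBody.BoseGas.floor_of_scatteringLength_pos_sharp`
(LSSY's localization mechanism — Lemma 5.2 in every well-occupied cell, the generalized Poincaré
inequality Lemma 4.1 on every sub-cell of every one-particle slice with the balls around the
same-cell particles removed, the cell method with a crowding penalty, and the Dyson upper bound —
run cell by cell on the big Dirichlet box with the depletion budget `ηN`: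
`sub_le_sum_occupation_of_budget`, `floorBudget_le_of_le`, `floorBudgetSum_eventually_le` of
`BoseGasSubcellCondensationSharp.lean`), followed by the identification
`∑_q ⟨u_q, γ_Ψ u_q⟩ = cohSum N L k Ψ` of the sub-cell modes of side `L/2^k` with the dyadic flat
modes (`sum_occupation_subMode_eq_cohSum`).

References: E. H. Lieb, R. Seiringer, J. P. Solovej, J. Yngvason, *The Mathematics of the Bose Gas
and its Condensation* (2005), Lemma 4.1, Lemma 5.2, Thm. 5.1 (5.15)–(5.17), Thm. 2.2, Thm. 2.4;
E. H. Lieb, R. Seiringer, Phys. Rev. Lett. 88 (2002) 170409.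
-/

noncomputable section

open MeasureTheory Filter Set
open scoped ENNReal NNReal Topology BigOperators

namespace Summit.AtomisticToContinuum.BoseEinsteinCondensation.Cruxes.TangentTransfer.Birth

open Literature.MathematicalPhysics.QuantumManyBody.BoseGas

/-- **STUB `stub_floorSharp` — the sharp pinned mesoscopic floor** (registered signature of the
line `registered`, skeleton v2, of the crux `TangentTransfer`).  For every repulsive finite-range
`v` with positive scattering length, every `η ∈ (0,1)` and every `M ≥ 1` there is `ρ₀ > 0` such
that for `0 < ρ < ρ₀`, eventually in `N`, there is `δ > 0` (namely `δ = 1`) such that for every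
`δ`-near-minimiser `Ψ` of the Dirichlet energy in the box of side `L = (N/ρ)^{1/3}` and every
dyadic level `k` with `M/√ρ ≤ L/2^k < 2M/√ρ`, `(1-η)N ≤ cohSum N L k Ψ.ψ`:
`floor_of_scatteringLength_pos_sharp`, then `sum_occupation_subMode_eq_cohSum`. [folklore] -/
theorem stub_floorSharp :
    ∀ v : ℝ → ℝ≥0∞, IsRepulsiveFiniteRange v → 0 < scatteringLength v →
      ∀ η : ℝ, 0 < η → η < 1 → ∀ M : ℝ, 1 ≤ M →
      ∃ ρ₀ : ℝ, 0 < ρ₀ ∧ ∀ ρ : ℝ, 0 < ρ → ρ < ρ₀ →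
        ∀ᶠ N : ℕ in atTop, ∃ δ : ℝ≥0∞, 0 < δ ∧ ∀ Ψ : TrialState N (sideLength ρ N),
          energy v Ψ ≤ groundStateEnergy v N (sideLength ρ N) + δ →
          ∀ k : ℕ, M / Real.sqrt ρ ≤ sideLength ρ N / 2 ^ k →
            sideLength ρ N / 2 ^ k < 2 * (M / Real.sqrt ρ) →
            ENNReal.ofReal ((1 - η) * N) ≤ cohSum N (sideLength ρ N) k Ψ.ψ := by
  intro v hv ha η hη _hη1 M hM
  have hMpos : 0 < M := by linarith
  obtain ⟨ρ₀, hρ₀, H⟩ := floor_of_scatteringLength_pos_sharp hv ha hη hMpos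
  refine ⟨ρ₀, hρ₀, fun ρ hρ hρlt => ?_⟩
  filter_upwards [H ρ hρ hρlt] with N hN
  refine ⟨1, one_pos, fun Ψ hΨ k hk1 hk2 => ?_⟩
  rw [← sum_occupation_subMode_eq_cohSum]
  exact hN Ψ hΨ k hk1 hk2

end Summit.AtomisticToContinuum.BoseEinsteinCondensation.Cruxes.TangentTransfer.Birth

end
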